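import Summits.KontsevichZagierPeriods.KontsevichZagierPeriods.Theorems.SoloInformedScissorsGroundAll
import Literature.NumberTheory.Transcendental.KZMonomialCompression
import HarnessLib
import HarnessLib.Audit

/-!
# SoloInformed — the COMPACTIFICATION LEMMA in the scissors calculus `𝒮` (part 3 of 3)

Solo programme `solo-KontsevichZagierPeriods-informed`, session s261 (file 3 of 3).

**Theorem** (`soloInformed_exists_isBounded_sub_mem_scissorsRel`, the COMPACTIFICATION LEMMA of
`nl-elimination.md` NF.4(3), previously recorded there as "plausible, not claimed").  Every volume
representation `A = (S, 1)` (`S ⊂ ℝⁿ` `ℚ`-semialgebraic of finite volume) is scissors congruent —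
inside `𝒮 = soloInformedScissorsRel`, i.e. by cutting along `ℚ`-semialgebraic sets up to null sets and
by volume-preserving `ℚ`-semialgebraic `C¹` bijections, *without the Newton–Leibniz rule and without
changing the dimension* — to a volume representation with BOUNDED domain.  Consequently every class of
`𝒦ₙ = ℤ[volume representations of dimension n]/𝒮` is represented by a bounded set.

**Proof.**  By `soloInformed_exists_downset_sub_mem_scissorsRel` (part 2) `A` is `𝒮`-congruent to a
down-set `D` of the open positive orthant.  By the tree's box-tail decay
(`DownSetTail.exists_prod_le_mul_rpow`) the monomial compression `Φ(x)ⱼ = xⱼ^η (∏ xᵢ)^β` of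
`KZMonomialCompression` (`η = 1/q`, `β = (q−1)/(q(m+1))`, constant Jacobian `q^{−m}`) maps `D` into a
box; composing with the linear rescaling `diag(q^m, 1, …, 1)` gives ONE `ℚ`-semialgebraic injective
`C¹` map `Ψ` with `|det DΨ| ≡ 1` and `Ψ(D)` bounded, so `[D] − [Ψ(D)]` is a single generator of `𝒮`
(`soloInformed_exists_isBounded_of_downset`).  (The tree's `KZ.exists_isBounded_of_downset` makes the
same two substitutions as two rule-(2) moves through the intermediate density `[Φ(D), q^m]`, which is
not a volume representation; here they are fused into one volume-preserving move.)

**Corollaries.**  `soloInformed_h3At_iff_h3BddAt` — the generalized Hilbert third problem `H3ₙ` of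
the calculus is equivalent to its restriction to bounded sets; `soloInformed_stableH3_iff_stableH3Bdd`
and `soloInformed_summit_iff_stableH3Bdd` — **the Kontsevich–Zagier period conjecture is equivalent to
the STABLE generalized Hilbert third problem for BOUNDED `ℚ`-semialgebraic sets**: two bounded
`ℚ`-semialgebraic sets of equal volume become scissors congruent (cut-and-paste up to null sets plus
volume-preserving `ℚ`-semialgebraic `C¹` maps) after multiplying both by a cube `[0,1]^k`.

References: [Kontsevich–Zagier 2001, §1.2]; [Viu-Sos 2021, Thm. 1.1 / Cor. 2.2] (compact semi-canonical
form via resolution — replaced here, as in the tree, by grounding + monomial compression); tree files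
`KZMonomialCompression`, `DownSetTailDecay`; this work (`nl-elimination.md` THEOREM NF, COROLLARY NF.2,
NF.4(3)).
-/

noncomputable section

open scoped BigOperators Topology ContDiff ENNReal

namespace Summit.KontsevichZagierPeriods.KontsevichZagierPeriods.Theorems

open Set MeasureTheory Filter
open Literature.ModelTheory.ExponentialFields
open Literature.NumberTheory.Transcendental Literature.NumberTheory.Transcendental.KZ

variable {m n : ℕ}

/-! ### Compressing a down-set onto a bounded set by one volume-preserving map -/

/-- **Finite-volume down-sets are scissors congruent to bounded sets, by ONE volume-preserving map.**
Let `D` be a volume representation in dimension `m + 1` whose domain is a coordinatewise down-set of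
the open positive orthant. Then `[D] − [B] ∈ 𝒮` for a volume representation `B` with BOUNDED domain:
`B = (Ψ(D), 1)` with `Ψ = diag(q^m, 1, …, 1) ∘ Φ`, `Φ(x)ⱼ = xⱼ^η (∏ xᵢ)^β` the monomial compression
(`|det DΨ| = q^m · η^m = 1`). [this work, nl-elimination.md NF.4(3); tree `KZ.exists_isBounded_of_downset`] -/
theorem soloInformed_exists_isBounded_of_downset (D : IntegralRep (m + 1))
    (hpos : ∀ x ∈ D.domain, ∀ i, 0 < x i)
    (hdown : ∀ x ∈ D.domain, ∀ y : Fin (m + 1) → ℝ, (∀ i, 0 < y i ∧ y i ≤ x i) → y ∈ D.domain)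
    (h1 : SoloInformedIsVolRep D) :
    ∃ B : IntegralRep (m + 1), Bornology.IsBounded B.domain ∧ SoloInformedIsVolRep B ∧
      of D - of B ∈ soloInformedScissorsRel := by
  classical
  have hfin : volume D.domain ≠ ⊤ := volume_ne_top_of_integrand_one D h1
  -- polynomial box decay of the down-set
  obtain ⟨C, α, hC, hα, hdecay⟩ :=
    DownSetTail.exists_prod_le_mul_rpow D.isSemialgebraic_domain hpos hdown hfin
  -- the exponents (as in `KZ.exists_isBounded_of_downset`)
  set q : ℕ := ⌈(m + 1 : ℝ) / α⌉₊ + 2 with hq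
  have hq1 : 1 ≤ q := by omega
  have hqR : (q : ℝ) = ⌈(m + 1 : ℝ) / α⌉₊ + 2 := by rw [hq]; push_cast; ring
  have hq0 : (0 : ℝ) < q := by rw [hqR]; positivity
  have hqα : (m + 1 : ℝ) ≤ α * (q - 1) := by
    have h1' : (m + 1 : ℝ) / α ≤ ⌈(m + 1 : ℝ) / α⌉₊ := Nat.le_ceil _
    have h2 : (m + 1 : ℝ) = α * ((m + 1 : ℝ) / α) := by field_simp
    rw [h2, hqR]
    exact mul_le_mul_of_nonneg_left (by linarith) hα.le
  set η : ℝ := 1 / q with hη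
  set β : ℝ := (q - 1) / (q * (m + 1)) with hβ
  have hηpos : 0 < η := by rw [hη]; positivity
  have hβpos : 0 ≤ β := by
    rw [hβ]
    apply div_nonneg
    · have : (1 : ℝ) ≤ q := by exact_mod_cast hq1
      linarith
    · positivity
  have hηβ : η + (m + 1) * β = 1 := by
    rw [hη, hβ]
    field_simp
    ring
  have hαβ : η ≤ α * β := by
    rw [hη, hβ, div_le_iff₀ hq0]
    have : α * ((↑q - 1) / (↑q * (↑m + 1))) * ↑q = α * (q - 1) / (m + 1) := by
      field_simp
    rw [this, le_div_iff₀ (by positivity)]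
    linarith
  -- the compression `Φ` and its bounded image
  have hsa := isSemialgebraicMapOn_monomialCompression q hq1 η β hη hβ D.isSemialgebraic_domain hpos
  set Φ : (Fin (m + 1) → ℝ) → (Fin (m + 1) → ℝ) := fun x j =>
    Real.exp (η * Real.log (x j) + β * ∑ i, Real.log (x i)) with hΦ
  set Φ' : (Fin (m + 1) → ℝ) → (Fin (m + 1) → ℝ) →L[ℝ] (Fin (m + 1) → ℝ) := fun x =>
    ContinuousLinearMap.pi fun j : Fin (m + 1) =>
      Real.exp (η * Real.log (x j) + β * ∑ i, Real.log (x i)) •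
        (η • ((x j)⁻¹ • ContinuousLinearMap.proj (R := ℝ) (φ := fun _ : Fin (m + 1) => ℝ) j) +
          β • ∑ i, (x i)⁻¹ • ContinuousLinearMap.proj (R := ℝ) (φ := fun _ : Fin (m + 1) => ℝ) i)
    with hΦ'
  have hΦd : ∀ x ∈ D.domain, HasFDerivAt Φ (Φ' x) x := fun x hx =>
    hasFDerivAt_monomialCompression η β (hpos x hx)
  have hΦdet : ∀ x ∈ D.domain, (Φ' x).det = η ^ m := fun x hx =>
    det_fderiv_monomialCompression η β hηpos.ne' hηβ (hpos x hx)
  have hΦinj : InjOn Φ D.domain :=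
    (injOn_monomialCompression η β hηpos.ne' hηβ).mono fun x hx => hpos x hx
  set M : ℝ := max 1 (Real.exp (β * Real.log C)) with hM
  have hbox : Φ '' D.domain ⊆ Icc (fun _ => 0) (fun _ => M) := by
    rintro _ ⟨x, hx, rfl⟩
    exact ⟨fun j => (Real.exp_pos _).le, fun j =>
      monomialCompression_le η β α C hηpos.le hβpos hαβ hC (hpos x hx) (hdecay x hx) j⟩
  have hTb : Bornology.IsBounded (Φ '' D.domain) := (Metric.isBounded_Icc _ _).subset hbox
  have hT : IsSemialgebraic ℚ (Φ '' D.domain) :=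
    IsSemialgebraicMapOn.isSemialgebraic_image_holds hsa subset_rfl D.isSemialgebraic_domain
  -- the linear rescaling `L = diag(q^m, 1, …, 1)`
  set d : Fin (m + 1) → ℚ := fun i => if i = 0 then (q : ℚ) ^ m else 1 with hd
  have hdR : ∀ i, (d i : ℝ) = if i = 0 then (q : ℝ) ^ m else 1 := fun i => by
    simp only [hd]
    split_ifs <;> simp
  have hd0 : ∀ i, (d i : ℝ) ≠ 0 := fun i => by
    rw [hdR]
    split_ifs
    · exact pow_ne_zero m hq0.ne'
    · norm_num
  set L : (Fin (m + 1) → ℝ) →L[ℝ] (Fin (m + 1) → ℝ) :=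
    LinearMap.toContinuousLinearMap (Matrix.toLin' (Matrix.diagonal fun i => (d i : ℝ))) with hL
  have hLapply : ∀ x i, L x i = (d i : ℝ) * x i := fun x i => by
    rw [hL, LinearMap.coe_toContinuousLinearMap', Matrix.toLin'_apply, Matrix.mulVec_diagonal]
  have hLdet : L.det = (q : ℝ) ^ m := by
    rw [ContinuousLinearMap.det, hL]
    simp only [LinearMap.coe_toContinuousLinearMap]
    rw [LinearMap.det_toLin', Matrix.det_diagonal]
    simp_rw [hdR]
    rw [Finset.prod_ite_eq']
    simp
  have hLsa : IsSemialgebraicMapOn ℚ (Φ '' D.domain) L := by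
    refine (isSemialgebraicMapOn_aeval hT fun j => MvPolynomial.C (d j) * MvPolynomial.X j).congr
      fun x _ => ?_
    funext j
    rw [hLapply]
    simp
  have hLinj : Function.Injective L := by
    intro x y hxy
    funext i
    have := congr_fun hxy i
    rw [hLapply, hLapply] at this
    exact mul_left_cancel₀ (hd0 i) this
  -- the fused move `Ψ = L ∘ Φ`
  set Ψ : (Fin (m + 1) → ℝ) → (Fin (m + 1) → ℝ) := fun x => L (Φ x) with hΨ
  have hΨsa : IsSemialgebraicMapOn ℚ D.domain Ψ :=
    IsSemialgebraicMapOn.comp_holds hLsa hsa (mapsTo_image Φ D.domain)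
  have hΨd : ∀ x ∈ D.domain, HasFDerivWithinAt Ψ (L.comp (Φ' x)) D.domain x := fun x hx =>
    (L.hasFDerivAt.comp x (hΦd x hx)).hasFDerivWithinAt
  have hΨinj : InjOn Ψ D.domain := fun x hx y hy hxy => hΦinj hx hy (hLinj hxy)
  have hΨdet : ∀ x ∈ D.domain, |(L.comp (Φ' x)).det| = 1 := fun x hx => by
    have : (L.comp (Φ' x)).det = L.det * (Φ' x).det := by
      change LinearMap.det ((L : (Fin (m + 1) → ℝ) →ₗ[ℝ] (Fin (m + 1) → ℝ)) ∘ₗ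
        (Φ' x : (Fin (m + 1) → ℝ) →ₗ[ℝ] (Fin (m + 1) → ℝ))) = _
      rw [LinearMap.det_comp]
    rw [this, hLdet, hΦdet x hx, ← mul_pow, hη, mul_one_div_cancel hq0.ne', one_pow, abs_one]
  have hΨim : Ψ '' D.domain = L '' (Φ '' D.domain) := by
    rw [image_image]
  have hBb : Bornology.IsBounded (Ψ '' D.domain) := by
    rw [hΨim]
    exact L.lipschitz.isBounded_image hTb
  have hBsa : IsSemialgebraic ℚ (Ψ '' D.domain) :=
    IsSemialgebraicMapOn.isSemialgebraic_image_holds hΨsa subset_rfl D.isSemialgebraic_domain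
  have hB1 : IsSemialgebraicFunOn ℚ (Ψ '' D.domain) fun _ => (1 : ℝ) := by
    simpa using isSemialgebraicFunOn_ratCast hBsa 1
  let B : IntegralRep (m + 1) := ⟨Ψ '' D.domain, fun _ => 1, hBsa, hB1,
    integrableOn_const hBb.measure_lt_top.ne⟩
  have hBv : SoloInformedIsVolRep B := fun _ _ => rfl
  exact ⟨B, hBb, hBv, soloInformed_mapGen_subset_scissorsRel
    (soloInformed_mem_mapGen h1 hBv Ψ (fun x => L.comp (Φ' x)) hΨsa hΨd hΨinj rfl hΨdet)⟩

/-! ### The compactification lemma -/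

/-- **COMPACTIFICATION LEMMA** (`nl-elimination.md` NF.4(3), now a theorem).  Every volume
representation is scissors congruent, inside `𝒮` (cutting up to null sets and volume-preserving
`ℚ`-semialgebraic `C¹` maps only), to a volume representation with bounded domain: in dimension `0`
every set is bounded; in dimension `m + 1` ground all coordinates
(`soloInformed_exists_downset_sub_mem_scissorsRel`) and compress
(`soloInformed_exists_isBounded_of_downset`). [this work, nl-elimination.md NF.4(3)] -/
theorem soloInformed_exists_isBounded_sub_mem_scissorsRel (A : IntegralRep n)
    (hA : SoloInformedIsVolRep A) :
    ∃ B : IntegralRep n, Bornology.IsBounded B.domain ∧ SoloInformedIsVolRep B ∧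
      of A - of B ∈ soloInformedScissorsRel := by
  cases n with
  | zero =>
    refine ⟨A, ?_, hA, by rw [sub_self]; exact zero_mem _⟩
    have hfin : (Set.univ : Set (Fin 0 → ℝ)).Finite := Set.finite_univ
    exact (hfin.subset (subset_univ _)).isBounded
  | succ m =>
    obtain ⟨D, hpos, hdown, hDv, hAD⟩ := soloInformed_exists_downset_sub_mem_scissorsRel A hA
    obtain ⟨B, hBb, hBv, hDB⟩ := soloInformed_exists_isBounded_of_downset D hpos hdown hDv
    refine ⟨B, hBb, hBv, ?_⟩
    have := add_mem hAD hDB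
    rwa [sub_add_sub_cancel] at this

/-- **Every class of `𝒦ₙ` has a bounded representative with the same volume** (the value is an
invariant of `𝒮`). [this work, nl-elimination.md NF.4(3)] -/
theorem soloInformed_exists_isBounded_value_eq (A : IntegralRep n) (hA : SoloInformedIsVolRep A) :
    ∃ B : IntegralRep n, Bornology.IsBounded B.domain ∧ SoloInformedIsVolRep B ∧
      B.value = A.value ∧ of A - of B ∈ soloInformedScissorsRel := by
  obtain ⟨B, hBb, hBv, hAB⟩ := soloInformed_exists_isBounded_sub_mem_scissorsRel A hA
  exact ⟨B, hBb, hBv, (Equivalent.value_eq_holds (soloInformed_scissorsRel_le_relations hAB)).symm, hAB⟩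

/-! ### Hilbert's third problem of the calculus: bounded sets suffice -/

/-- `H3^bdd_n`: the generalized Hilbert third problem of the calculus in dimension `n`, for BOUNDED
sets only — two bounded volume representations with the same volume are scissors congruent.
[this work] -/
def SoloInformedH3BddAt (n : ℕ) : Prop :=
  ∀ (r r' : IntegralRep n), SoloInformedIsVolRep r → SoloInformedIsVolRep r' →
    Bornology.IsBounded r.domain → Bornology.IsBounded r'.domain →
    r.value = r'.value → of r - of r' ∈ soloInformedScissorsRel

/-- **`H3_n ⟺ H3^bdd_n`**: by the compactification lemma the generalized Hilbert third problem of the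
calculus reduces to bounded sets. [this work, nl-elimination.md NF.4(3)] -/
theorem soloInformed_h3At_iff_h3BddAt (n : ℕ) : SoloInformedH3At n ↔ SoloInformedH3BddAt n := by
  constructor
  · intro h r r' hr hr' _ _ hv
    exact h r r' hr hr' hv
  · intro h r r' hr hr' hv
    obtain ⟨b, hbb, hbv, hbval, hrb⟩ := soloInformed_exists_isBounded_value_eq r hr
    obtain ⟨b', hb'b, hb'v, hb'val, hr'b'⟩ := soloInformed_exists_isBounded_value_eq r' hr'
    have hbb' : of b - of b' ∈ soloInformedScissorsRel :=
      h b b' hbv hb'v hbb hb'b (by rw [hbval, hb'val, hv])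
    have : of r - of r' = (of r - of b) + (of b - of b') - (of r' - of b') := by abel
    rw [this]
    exact sub_mem (add_mem hrb hbb') hr'b'

/-- `STABLE-H3^bdd`: the stable generalized Hilbert third problem of the calculus for BOUNDED sets —
two bounded volume representations (any dimension) with the same volume become scissors congruent
after finitely many flattenings `× [0,1]`. [this work] -/
def SoloInformedStableH3Bdd : Prop :=
  ∀ (n : ℕ) (r r' : IntegralRep n), SoloInformedIsVolRep r → SoloInformedIsVolRep r' →
    Bornology.IsBounded r.domain → Bornology.IsBounded r'.domain → r.value = r'.value →
      ∃ k, of (soloInformedFlatIter r k) - of (soloInformedFlatIter r' k) ∈ soloInformedScissorsRel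

/-- **`STABLE-H3 ⟺ STABLE-H3^bdd`**: compactify both representations at stage `0` (the
compactification lemma) and carry the congruence through the flattenings
(`soloInformed_flatIter_sub_mem_scissorsRel_of_le`). [this work, nl-elimination.md NF.4(3)] -/
theorem soloInformed_stableH3_iff_stableH3Bdd : SoloInformedStableH3 ↔ SoloInformedStableH3Bdd := by
  constructor
  · intro h n r r' hr hr' _ _ hv
    exact h n r r' hr hr' hv
  · intro h n r r' hr hr' hv
    obtain ⟨b, hbb, hbv, hbval, hrb⟩ := soloInformed_exists_isBounded_value_eq r hr
    obtain ⟨b', hb'b, hb'v, hb'val, hr'b'⟩ := soloInformed_exists_isBounded_value_eq r' hr'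
    obtain ⟨k, hk⟩ := h n b b' hbv hb'v hbb hb'b (by rw [hbval, hb'val, hv])
    refine ⟨k, ?_⟩
    have hrbk : of (soloInformedFlatIter r k) - of (soloInformedFlatIter b k) ∈
        soloInformedScissorsRel :=
      soloInformed_flatIter_sub_mem_scissorsRel_of_le (Nat.zero_le k) hrb
    have hr'b'k : of (soloInformedFlatIter r' k) - of (soloInformedFlatIter b' k) ∈
        soloInformedScissorsRel :=
      soloInformed_flatIter_sub_mem_scissorsRel_of_le (Nat.zero_le k) hr'b'
    have : of (soloInformedFlatIter r k) - of (soloInformedFlatIter r' k) =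
        (of (soloInformedFlatIter r k) - of (soloInformedFlatIter b k)) +
        (of (soloInformedFlatIter b k) - of (soloInformedFlatIter b' k)) -
        (of (soloInformedFlatIter r' k) - of (soloInformedFlatIter b' k)) := by abel
    rw [this]
    exact sub_mem (add_mem hrbk hk) hr'b'k

/-- **The period conjecture is the stable generalized Hilbert third problem for bounded
`ℚ`-semialgebraic sets**: `KontsevichZagierPeriods ⟺ STABLE-H3^bdd`.
[this work, COROLLARY NF.2 + nl-elimination.md NF.4(3)] -/
theorem soloInformed_summit_iff_stableH3Bdd : KontsevichZagierPeriods ↔ SoloInformedStableH3Bdd :=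
  soloInformed_summit_iff_stableH3.trans soloInformed_stableH3_iff_stableH3Bdd

end Summit.KontsevichZagierPeriods.KontsevichZagierPeriods.Theorems

end
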